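import Summits.AnomalousDissipation.AnomalousDissipation.Theorems.SolenoidalFractalHomogenisationLagrangianStepTemplateSuperSmallHi
import HarnessLib

/-!
# K1L_D (stmt-AnomalousDissipation-27980), stub `stub_windowFactsH`: `hi_tails_le_eps` — the (Hi) tails of W3-E (ii) are below the slop `ε`
# (helper; `--supports … --as helper`; lead-k1l-onelevel-p1 g3)

Conclusion of the (Hi) reduction: with `Lcap := ⌊ρ^(1/64)·N(m+1)·cellVisc(m+1)/√c⌋₊`, `L := Lcap/2`, `L' := L/2` (the levels at which
`hi_of_bandKill` (p667802) is applied to W3-E §4c v27), for every template carrier and all `m ≥ m⋆(E)`, every window length `τ ≥ refresh(m+1)`: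
`exp(−rateLo(L')·τ/2) + exp(−c₃/θ(m+1)) + exp(−(L−L')/(C₂ N_m)) ≤ ρ^σw · (1 − e^(−4π² kbar_m lo)) · refresh(m+1) = ε`.
Ingredients: …TemplateSuperSmall (p668981), …TemplateSuperSmallHi (part 1): `L' ≥ X/8`, `L − L' ≥ (X−2)/4` for `X ≥ 8` (`X` = the cap argument
`≥ (K/√c) s^(15/4) N_m`), the `e₁`-exponent bound `rateLo(L')·τ/2 ≥ (π²/16)·lo·M·W.period·s^(1/2)`, and `ε ≥ c₁(E)/s^p`.  Pure template
arithmetic; NOT a proof of the stub, of the crux, or of AD; rung F-D1.A0.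
-/

set_option linter.dupNamespace false

noncomputable section

namespace Summit.AnomalousDissipation.AnomalousDissipation.Theorems.SolenoidalFractalHomogenisation.LagrangianStep

open Filter Topology
open Literature.Analysis.FluidPDE.LatticeShear
open Summit.AnomalousDissipation.AnomalousDissipation.Theorems.SolenoidalFractalHomogenisation.LagrangianRenormalisationStep (cellVisc_pos')
open Summit.AnomalousDissipation.AnomalousDissipation.Theorems.SolenoidalFractalHomogenisation.PermissibleCarrier (period_pos)

variable {k : ℕ}

/-! ## The band levels below the cap -/

/-- For `X ≥ 8`, `Lcap = ⌊X⌋₊`, `L = Lcap/2`, `L' = L/2`: `X/8 ≤ L'` and `(X − 2)/4 ≤ L − L'`, and `2 L' ≤ L`. -/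
theorem band_levels {X : ℝ} (hX : 8 ≤ X) {Lcap L L' : ℕ} (hLcap : Lcap = ⌊X⌋₊) (hL : L = Lcap / 2) (hL' : L' = L / 2) :
    X / 8 ≤ (L' : ℝ) ∧ (X - 2) / 4 ≤ (L : ℝ) - L' ∧ 2 * L' ≤ L := by
  have h1 : X - 1 ≤ (Lcap : ℝ) := by rw [hLcap]; exact (Nat.sub_one_lt_floor X).le
  have h2 : ((Lcap : ℝ) - 1) / 2 ≤ (L : ℝ) := by rw [hL]; exact cast_div_two_ge Lcap
  have h3 : ((L : ℝ) - 1) / 2 ≤ (L' : ℝ) := by rw [hL']; exact cast_div_two_ge L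
  have h4 : (L' : ℝ) ≤ (L : ℝ) / 2 := by rw [hL']; exact cast_div_two_le L
  refine ⟨by linarith, by linarith, ?_⟩
  rw [hL']; omega

/-! ## The `e₁` exponent -/

/-- **The `e₁` exponent grows like `s^(1/2)`**: if `L' ≥ X/8` with `X = ρ^(1/64)·N(m+1)·ν/√c` and `τ ≥ refresh(m+1)`, then
`(π²/16)·lo·M·W.period·s^(1/2) ≤ a(m+1)·(8π² L'² lo (ν + c/ν)/n²)·τ/2`. -/
theorem e1_exponent_ge (E : LagrangianLatticeCarrier k) {W : LatticeWord k} {M : ℝ} {hM : 0 < M}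
    (hW : E.design = W.stretch M hM)
    (hT5 : ∀ m, ((E.N (m + 1) : ℝ) / E.N m) ^ (1 / 16 : ℝ) * E.physPeriod (m + 1) ≤ E.refresh (m + 1))
    {lo c : ℝ} (hlo : 0 < lo) (hc : 0 < c) (m : ℕ) {L' : ℕ}
    (hL' : ((E.N m : ℝ) / E.N (m + 1)) ^ (1 / 64 : ℝ) * ((E.N (m + 1) : ℝ) * E.cellVisc (m + 1)) / Real.sqrt c / 8 ≤ (L' : ℝ))
    {τ : ℝ} (hτ : E.refresh (m + 1) ≤ τ) :
    Real.pi ^ 2 / 16 * lo * (M * W.period) * (((E.N (m + 1) : ℝ) / E.N m) ^ (1 / 16 : ℝ)) ^ (1 / 2 : ℝ)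
      ≤ E.a (m + 1) * (8 * Real.pi ^ 2 * (L' : ℝ) ^ 2 * lo * (E.cellVisc (m + 1) + c / E.cellVisc (m + 1))
          / (E.N (m + 1) : ℝ) ^ 2) * τ / 2 := by
  set s : ℝ := ((E.N (m + 1) : ℝ) / E.N m) ^ (1 / 16 : ℝ) with hs_def
  have hs0 : 0 < s := sep16_pos E.toFractalCarrierData m
  set q : ℝ := s ^ (1 / 4 : ℝ) with hq_def
  have hq0 : 0 < q := Real.rpow_pos_of_pos hs0 _
  set ν : ℝ := E.cellVisc (m + 1) with hν_def
  have hν : 0 < ν := cellVisc_pos' E.toFractalCarrierData (m + 1)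
  set n : ℝ := (E.N (m + 1) : ℝ) with hn_def
  have hn : 0 < n := by rw [hn_def]; exact_mod_cast E.N_pos (m + 1)
  have ha : 0 < E.a (m + 1) := E.a_pos (m + 1)
  have hr : 0 < E.refresh (m + 1) := E.refresh_pos (m + 1)
  have hWp : 0 < W.period := period_pos W
  have hsc : 0 < Real.sqrt c := Real.sqrt_pos.2 hc
  -- `ρ^{1/64} = q⁻¹`
  have hρq : ((E.N m : ℝ) / E.N (m + 1)) ^ (1 / 64 : ℝ) = q⁻¹ := rho_rpow_one_div_64 E.toFractalCarrierData m
  rw [hρq] at hL'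
  -- `L'² ≥ (nν)²/(64 c q²)`
  have hL'0 : 0 ≤ q⁻¹ * (n * ν) / Real.sqrt c / 8 := by positivity
  have hsq : (q⁻¹ * (n * ν) / Real.sqrt c / 8) ^ 2 ≤ (L' : ℝ) ^ 2 := pow_le_pow_left₀ hL'0 hL' 2
  have hsq' : (q⁻¹ * (n * ν) / Real.sqrt c / 8) ^ 2 = (n * ν) ^ 2 / (64 * c * q ^ 2) := by
    field_simp
    rw [Real.sq_sqrt hc.le]; ring
  rw [hsq'] at hsq
  -- `a ν r ≥ M Wp s`
  have havr : M * W.period * s ≤ E.a (m + 1) * ν * E.refresh (m + 1) := MWp_sep16_le_a_cellVisc_refresh E hW hT5 m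
  -- `q² = s^{1/2}` and `s = s^{1/2} s^{1/2}`
  have hq2 : q ^ 2 = s ^ (1 / 2 : ℝ) := by
    rw [hq_def, ← Real.rpow_natCast, ← Real.rpow_mul hs0.le]; norm_num
  have hss : s = s ^ (1 / 2 : ℝ) * s ^ (1 / 2 : ℝ) := by
    rw [← Real.rpow_add hs0]; norm_num
  have hs12 : 0 < s ^ (1 / 2 : ℝ) := Real.rpow_pos_of_pos hs0 _
  -- lower bound chain
  have hνc : c / ν ≤ ν + c / ν := by linarith
  have step1 : E.a (m + 1) * (8 * Real.pi ^ 2 * (L' : ℝ) ^ 2 * lo * (c / ν) / n ^ 2) * E.refresh (m + 1) / 2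
      ≤ E.a (m + 1) * (8 * Real.pi ^ 2 * (L' : ℝ) ^ 2 * lo * (ν + c / ν) / n ^ 2) * τ / 2 := by
    have h1 : E.a (m + 1) * (8 * Real.pi ^ 2 * (L' : ℝ) ^ 2 * lo * (c / ν) / n ^ 2)
        ≤ E.a (m + 1) * (8 * Real.pi ^ 2 * (L' : ℝ) ^ 2 * lo * (ν + c / ν) / n ^ 2) := by
      gcongr
    have h0 : 0 ≤ E.a (m + 1) * (8 * Real.pi ^ 2 * (L' : ℝ) ^ 2 * lo * (ν + c / ν) / n ^ 2) := by positivity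
    have := mul_le_mul h1 hτ hr.le h0
    linarith
  refine le_trans ?_ step1
  -- `a · L'² · (c/ν) · r /n² ≥ …`: substitute the two lower bounds
  have hs12q : s ^ (1 / 2 : ℝ) = s / q ^ 2 := by
    have e : s ^ (1 / 2 : ℝ) * q ^ 2 = s := by rw [hq2, ← hss]
    rw [eq_div_iff (pow_pos hq0 2).ne']; exact e
  have step2 : Real.pi ^ 2 / 16 * lo * (M * W.period) * s ^ (1 / 2 : ℝ)
      = 8 * Real.pi ^ 2 * ((n * ν) ^ 2 / (64 * c * q ^ 2)) * lo * (c / ν) / n ^ 2 * (M * W.period * s) / (2 * ν) := by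
    rw [hs12q]
    field_simp
    ring
  rw [step2]
  have step3 : 8 * Real.pi ^ 2 * ((n * ν) ^ 2 / (64 * c * q ^ 2)) * lo * (c / ν) / n ^ 2 * (M * W.period * s) / (2 * ν)
      ≤ 8 * Real.pi ^ 2 * (L' : ℝ) ^ 2 * lo * (c / ν) / n ^ 2 * (M * W.period * s) / (2 * ν) := by
    gcongr
  refine step3.trans ?_
  have step4 : 8 * Real.pi ^ 2 * (L' : ℝ) ^ 2 * lo * (c / ν) / n ^ 2 * (M * W.period * s) / (2 * ν)
      ≤ 8 * Real.pi ^ 2 * (L' : ℝ) ^ 2 * lo * (c / ν) / n ^ 2 * (E.a (m + 1) * ν * E.refresh (m + 1)) / (2 * ν) := by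
    gcongr
  refine step4.trans (le_of_eq ?_)
  field_simp

/-! ## The main estimate -/

set_option maxHeartbeats 400000 in
/-- **`hi_tails_le_eps`.**  See the module docstring. -/
theorem hi_tails_le_eps (E : LagrangianLatticeCarrier k) {W : LatticeWord k} {M : ℝ} {hM : 0 < M}
    (hW : E.design = W.stretch M hM) (hL : E.LPermissible) (hsq : ∀ m, E.N m ^ 2 ≤ E.N (m + 1))
    (hT2 : ∀ m, E.cellVisc (m + 1) * ((E.N (m + 1) : ℝ) / E.N m) ^ (1 / 4 : ℝ) ≤ 1)
    (hT3 : ∀ m, E.K * ((E.N (m + 1) : ℝ) / E.N m) ^ (1 / 4 : ℝ) ≤ ((E.N (m + 1) : ℝ) / E.N m) * E.cellVisc (m + 1))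
    {θ₀ : ℝ} (hθ₀ : 0 < θ₀) (hT4 : ∀ m, E.θ (m + 1) * ((E.N (m + 1) : ℝ) / E.N m) ^ (1 / 16 : ℝ) ≤ θ₀)
    (hT5 : ∀ m, ((E.N (m + 1) : ℝ) / E.N m) ^ (1 / 16 : ℝ) * E.physPeriod (m + 1) ≤ E.refresh (m + 1))
    {lo c C₂ c₃ : ℝ} (σw : ℝ) (hlo : 0 < lo) (hc : 0 < c) (hC₂ : 1 ≤ C₂) (hc₃ : 0 < c₃) :
    ∃ mstar : ℕ, ∀ m, mstar ≤ m → ∀ τ : ℝ, E.refresh (m + 1) ≤ τ →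
      ∀ Lcap L L' : ℕ, Lcap = ⌊((E.N m : ℝ) / E.N (m + 1)) ^ (1 / 64 : ℝ) * ((E.N (m + 1) : ℝ) * E.cellVisc (m + 1)) / Real.sqrt c⌋₊ →
        L = Lcap / 2 → L' = L / 2 →
      Real.exp (-(E.a (m + 1) * (8 * Real.pi ^ 2 * (L' : ℝ) ^ 2 * lo * (E.cellVisc (m + 1) + c / E.cellVisc (m + 1))
            / (E.N (m + 1) : ℝ) ^ 2) * τ / 2))
        + (Real.exp (-(c₃ / E.θ (m + 1))) + Real.exp (-(((L : ℝ) - L') / (C₂ * E.N m))))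
        ≤ ((E.N m : ℝ) / E.N (m + 1)) ^ σw * (1 - Real.exp (-(4 * Real.pi ^ 2 * (E.kbar m * lo)))) * E.refresh (m + 1) := by
  have hP : E.toFractalCarrierData.Permissible := hL.1
  have hK : 0 < E.K := E.K_pos
  have hsc : 0 < Real.sqrt c := Real.sqrt_pos.2 hc
  have hWp : 0 < W.period := period_pos W
  have hk0 : 0 < E.kbar 0 := E.kbar_pos 0
  have hg : 0 < E.gain := E.gain_pos
  -- the polynomial floor of `ε`
  set c₁ : ℝ := M * W.period * min (1 / (4 * E.kbar 0)) (Real.pi ^ 2 * lo * E.gain) with hc₁_def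
  have hc₁ : 0 < c₁ := by rw [hc₁_def]; exact mul_pos (mul_pos hM hWp) (lt_min (by positivity) (by positivity))
  set p : ℕ := ⌈16 * σw⌉₊ + 63 with hp_def
  -- eventual requirements
  obtain ⟨mX, hmX⟩ := exists_forall_le_sep16 E.toFractalCarrierData hP hsq (8 * Real.sqrt c / E.K)
  obtain ⟨mA, hmA⟩ := exists_forall_exp_neg_rpow_mul_pow_le E.toFractalCarrierData hP hsq
    (fun m => Real.pi ^ 2 / 16 * lo * (M * W.period) * (((E.N (m + 1) : ℝ) / E.N m) ^ (1 / 16 : ℝ)) ^ (1 / 2 : ℝ))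
    (c := Real.pi ^ 2 / 16 * lo * (M * W.period)) (a := 1 / 2) (by positivity) (by norm_num) (fun m => le_rfl) p
    (B := c₁ / 3) (by positivity)
  obtain ⟨mB, hmB⟩ := exists_forall_exp_neg_rpow_mul_pow_le E.toFractalCarrierData hP hsq
    (fun m => c₃ / θ₀ * (((E.N (m + 1) : ℝ) / E.N m) ^ (1 / 16 : ℝ)) ^ (1 : ℝ))
    (c := c₃ / θ₀) (a := 1) (by positivity) (by norm_num) (fun m => le_rfl) p (B := c₁ / 3) (by positivity)
  obtain ⟨mC, hmC⟩ := exists_forall_exp_neg_rpow_mul_pow_le E.toFractalCarrierData hP hsq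
    (fun m => E.K / (4 * Real.sqrt c * C₂) * (((E.N (m + 1) : ℝ) / E.N m) ^ (1 / 16 : ℝ)) ^ (15 / 4 : ℝ))
    (c := E.K / (4 * Real.sqrt c * C₂)) (a := 15 / 4) (by positivity) (by norm_num) (fun m => le_rfl) p
    (B := c₁ / 3 / Real.exp (1 / 2)) (by positivity)
  refine ⟨max mX (max mA (max mB mC)), fun m hm τ hτ Lcap L L' hLcap hLdef hL'def => ?_⟩
  have hmX' := hmX m (le_trans (le_max_left _ _) hm)
  have hmA' := hmA m (le_trans ((le_max_left _ _).trans (le_max_right _ _)) hm)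
  have hmB' := hmB m (le_trans (((le_max_left _ _).trans (le_max_right _ _)).trans (le_max_right _ _)) hm)
  have hmC' := hmC m (le_trans (((le_max_right _ _).trans (le_max_right _ _)).trans (le_max_right _ _)) hm)
  set s : ℝ := ((E.N (m + 1) : ℝ) / E.N m) ^ (1 / 16 : ℝ) with hs_def
  have hs1 : 1 ≤ s := one_le_sep16 E.toFractalCarrierData hP m
  have hs0 : 0 < s := by linarith
  have hsp : 0 < s ^ p := pow_pos hs0 p
  have hN1 : (1 : ℝ) ≤ E.N m := by exact_mod_cast E.N_pos m
  -- `X ≥ (K/√c) s^{15/4} N_m ≥ 8`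
  set X : ℝ := ((E.N m : ℝ) / E.N (m + 1)) ^ (1 / 64 : ℝ) * ((E.N (m + 1) : ℝ) * E.cellVisc (m + 1)) / Real.sqrt c with hX_def
  have hX1 : E.K / Real.sqrt c * s ^ (15 / 4 : ℝ) * E.N m ≤ X := cap_arg_ge_mul_N E.toFractalCarrierData hT3 hc m
  have hs154 : s ≤ s ^ (15 / 4 : ℝ) := by
    conv_lhs => rw [← Real.rpow_one s]
    exact Real.rpow_le_rpow_of_exponent_le hs1 (by norm_num)
  have hX8 : 8 ≤ X := by
    have h1 : 8 * Real.sqrt c / E.K ≤ s := hmX'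
    have h2 : 8 ≤ E.K / Real.sqrt c * s := by
      rw [div_le_iff₀ hK] at h1; rw [div_mul_eq_mul_div, le_div_iff₀ hsc]; linarith
    have h3 : E.K / Real.sqrt c * s ≤ E.K / Real.sqrt c * s ^ (15 / 4 : ℝ) * E.N m := by
      have := mul_le_mul (mul_le_mul_of_nonneg_left hs154 (by positivity : 0 ≤ E.K / Real.sqrt c)) hN1 zero_le_one
        (by positivity)
      simpa using this
    linarith
  obtain ⟨hL'ge, hgap, _h2L⟩ := band_levels hX8 hLcap hLdef hL'def
  -- term 1
  have he1 := e1_exponent_ge E hW hT5 hlo hc m (L' := L') (by rw [← hX_def]; linarith) hτ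
  have ht1 : Real.exp (-(E.a (m + 1) * (8 * Real.pi ^ 2 * (L' : ℝ) ^ 2 * lo * (E.cellVisc (m + 1) + c / E.cellVisc (m + 1))
            / (E.N (m + 1) : ℝ) ^ 2) * τ / 2)) ≤ c₁ / 3 / s ^ p := by
    rw [le_div_iff₀ hsp]
    refine le_trans ?_ hmA'
    exact mul_le_mul_of_nonneg_right (Real.exp_le_exp.2 (by linarith)) hsp.le
  -- term 2
  have hθ : 0 < E.θ (m + 1) := E.θ_pos (m + 1)
  have ht2 : Real.exp (-(c₃ / E.θ (m + 1))) ≤ c₁ / 3 / s ^ p := by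
    rw [le_div_iff₀ hsp]
    refine le_trans ?_ hmB'
    refine mul_le_mul_of_nonneg_right (Real.exp_le_exp.2 ?_) hsp.le
    rw [Real.rpow_one]
    -- `c₃/θ₀ · s ≤ c₃/θ` from `θ s ≤ θ₀`
    have h := hT4 m
    rw [← hs_def] at h
    rw [neg_le_neg_iff, div_mul_eq_mul_div, div_le_div_iff₀ hθ₀ hθ]
    nlinarith
  -- term 3
  have hNm : (0 : ℝ) < E.N m := by exact_mod_cast E.N_pos m
  have ht3 : Real.exp (-(((L : ℝ) - L') / (C₂ * E.N m))) ≤ c₁ / 3 / s ^ p := by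
    have hx : E.K / (4 * Real.sqrt c * C₂) * s ^ (15 / 4 : ℝ) - 1 / 2 ≤ ((L : ℝ) - L') / (C₂ * E.N m) := by
      rw [le_div_iff₀ (by positivity)]
      have h1 : (X - 2) / 4 * 1 ≤ ((L : ℝ) - L') * 1 := by linarith
      have h2 : E.K / Real.sqrt c * s ^ (15 / 4 : ℝ) * E.N m - 2 ≤ X - 2 := by linarith
      have hCN : 1 ≤ C₂ * E.N m := by nlinarith
      have e : (E.K / (4 * Real.sqrt c * C₂) * s ^ (15 / 4 : ℝ) - 1 / 2) * (C₂ * E.N m)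
          = (E.K / Real.sqrt c * s ^ (15 / 4 : ℝ) * E.N m) / 4 - C₂ * E.N m / 2 := by
        field_simp
      rw [e]
      nlinarith
    have h4 : Real.exp (-(((L : ℝ) - L') / (C₂ * E.N m)))
        ≤ Real.exp (1 / 2) * Real.exp (-(E.K / (4 * Real.sqrt c * C₂) * s ^ (15 / 4 : ℝ))) := by
      rw [← Real.exp_add]; exact Real.exp_le_exp.2 (by linarith)
    rw [le_div_iff₀ hsp]
    have h5 := mul_le_mul_of_nonneg_left hmC' (Real.exp_pos (1 / 2)).le
    have e2 : Real.exp (1 / 2) * (c₁ / 3 / Real.exp (1 / 2)) = c₁ / 3 := by field_simp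
    rw [e2] at h5
    calc Real.exp (-(((L : ℝ) - L') / (C₂ * E.N m))) * s ^ p
        ≤ Real.exp (1 / 2) * Real.exp (-(E.K / (4 * Real.sqrt c * C₂) * s ^ (15 / 4 : ℝ))) * s ^ p :=
          mul_le_mul_of_nonneg_right h4 hsp.le
      _ = Real.exp (1 / 2) * (Real.exp (-(E.K / (4 * Real.sqrt c * C₂) * s ^ (15 / 4 : ℝ))) * s ^ p) := by ring
      _ ≤ c₁ / 3 := h5
  -- the slop
  have heps := eps_ge E hW hL hsq hT2 hT5 σw hlo m
  rw [← hs_def, ← hc₁_def, ← hp_def] at heps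
  have hsum : c₁ / 3 / s ^ p + (c₁ / 3 / s ^ p + c₁ / 3 / s ^ p) = c₁ / s ^ p := by ring
  linarith [ht1, ht2, ht3, heps, hsum]

end Summit.AnomalousDissipation.AnomalousDissipation.Theorems.SolenoidalFractalHomogenisation.LagrangianStep

end
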